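import Summits.QuantumFields.YangMills.Theorems.UnitScaleTiltProp7FlatGaugeProjectorTower
import Summits.QuantumFields.YangMills.Theorems.UnitScaleTiltProp7SectET3DeltaPiT3PInv
import Summits.QuantumFields.YangMills.Theorems.UnitScaleTiltProp7SectET3RealCoordSums
import HarnessLib

/-!
# Route `UnitScaleTilt`, crux K1 «MinimiserStabilityRegPr» (stmt-QuantumFields-19200), stub `stub_existenceMinimalOrbit` (EX) — N06 print row `hPcol` of the EX display
# (S34ᴸ ✓p715121 ll.218–223), FLAT-CERTIFICATE ROAD «hPcol(1)», FILE 3∕4 «THE ROUTE's `G′ᴾ(1)∘R_S(1)` IS THE NE9 TOWER's `G′_k(1)∘R_k(1)`»: along the member's period identity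
# ✓`Prop7BlockPoincareKerQprime.periodsT3_eq_towerP`, the `L²` site cast `Φ := siteL2Cast ℂ (periodsT3_eq_towerP F n K hnK)` carries the composite of the route's pinv letter
# `GprimeP … a 1` (✓`Prop7SectET3DeltaPiPInv`, the Moore–Penrose pseudo-inverse of the TREE's `Δ′_a(1) = D*D + a·(Q∘D)†(Q∘D)`) with the route's gauge projector `RS … 1`
# onto the tower word `GpOfUk … 1 a′ ∘ RofUk … 1` (print's penalised `G′_k(1) = (Δ^η_1 + a′Q̃′_k†Q̃′_k)⁻¹` after print's `R_k(1)`), FOR EVERY PAIR OF PENALTIES `0 ≤ a`, `0 < a′`: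
# **`Φ (G′ᴾ(1)(R_S(1) l)) = G′_k(1)(R_k(1)(Φ l))`** — memo `LOCATE-HPCOL-FLATCERT-px20g7.md` §2 (19200 evidence #43)

Cell `ym3-torus`, width seat `ym3-torus-px20` (gen 7).  THEOREMS ONLY (0 `def`, 0 `sorry`); `--supports stmt-QuantumFields-19200 --as helper`, count-neutral.  YM₃ on T³ is a ladder
rung (R3), not the Clay problem; nothing here claims `hPcol`, N06, the stub, the crux or the mass gap.

WHY THE IDENTITY HOLDS ALTHOUGH THE TWO GREEN's FUNCTIONS DIFFER (memo §1 NOTE).  The tree's `Δ′_a(1)` is MASSLESS off the residual algebra (its penalty `a·(Q∘D)†(Q∘D)` is a coarse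
Laplacian of block means), the tower's `Δ′_{a′,k}(1)` is MASSIVE; but `R_S(1) l = Δ^η_1 μ` with `μ ∈ N_S(1)` (✓`exists_mem_NS_RS_eq`), `N_S(1)` = constant block sums (✓F3a
`toL2S_mem_NS_one_iff`), so `μ = μ₀ + const` with all block sums of `μ₀` zero and `Δ^η_1 μ = Δ^η_1 μ₀`; on such `μ₀` BOTH penalties vanish: route side `Δ′_a(1)μ₀ = Δ^η_1μ₀`
(✓`laplacePrimeA_apply_of_mem_NS`) and ★★✓`GprimeP_laplacePrimeA` give `G′ᴾ(1)(Δ^η_1μ₀) = μ₀ − P₀μ₀ = μ₀` (`P₀` = projection onto `ker D_1` = the constants (§1), and `μ₀ ⊥` constants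
because its total sum vanishes (§2)); tower side `Q̃′_k(1)(Φμ₀) = 0` (✓F3b `QprimeTowerW_one_cast_eq_zero_iff`) and lit ✓`B9Eq324DeltaPrimeATower.GpOfUk_gaugeMode` give
`G′_k(1)(Δ_1(Φμ₀)) = Φμ₀`; ★★★✓F3b `siteL2Cast_RS_one` + lit ✓`covLaplaceSiteK_one_siteL2Cast` move `R_S(1)` and `Δ^η_1` across the cast.

WHAT IS PROVED (ns `Summit.QuantumFields.YangMills.Theorems.Prop7FlatGprimeRSTower`; member `F n K`, `hnK : n < K`, weights `c₀ cB`).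
* §1 `exists_const_of_DL2_one_eq_zero` (`ker D_1` = the constant gauge parameters: ✓`DL2_one_toL2S` + ✓F3a `eq_default_of_forall_shift`).
* §2 `sum_eq_sum_blockSum` (a site sum is the sum of its `(K−n)`-block sums), `inner_const_toL2S_eq_zero_of_blockSum_eq_zero`, `kerDProj_one_eq_zero_of_blockSum_eq_zero` (`P₀(1)μ₀ = 0`).
* §3 `GprimeP_one_covLapSite_of_blockSum_eq_zero` (`G′ᴾ(1)(Δ^η_1 μ₀) = μ₀`), `covLaplaceSiteK_one_cast` (`Δ_tower(Φ l) = Φ(Δ^η_1 l)`),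
  ★★★ `siteL2Cast_GprimeP_RS_one` — `Φ (GprimeP F n K _ c₀ cB a 1 (RS F n K _ c₀ cB 1 l)) = GpOfUk F.L _ (K−n−1) frobEquiv (eta F n K) 1 a′ hpos′ (RofUk F.L _ (K−n−1) frobEquiv (eta F n K) 1 (Φ l))`
  for every `0 ≤ a`, every tower penalty∕coarse weight `a′, c₁ > 0` and every positivity witness `hpos′` of the tower's `Δ′_{a′,k}(1)`.
HONEST SCOPE.  Flat member only; finite-dimensional linear algebra + index bookkeeping over landed letters; no estimate.  Rung R3, not Clay; YM gap NOT proved.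

References: T. Bałaban, CMP **99** (1985) 389–434 [Balaban1985BackgroundPropagators] ((3.21)–(3.25) p.394, (3.115) p.418); CMP **96** (1984) 223–250 [Balaban1984PropagatorsII]
((2.10)–(2.12) p.225); CMP **102** (1985) 277–309 [Balaban1985Variational] (p.299 l.6).
-/

set_option autoImplicit false

noncomputable section

open scoped InnerProductSpace ComplexConjugate Matrix.Norms.L2Operator BigOperators

namespace Summit.QuantumFields.YangMills.Theorems.Prop7FlatGprimeRSTower

open Literature.MathematicalPhysics.QuantumFieldTheory.Balaban1983to89
open Literature.MathematicalPhysics.QuantumFieldTheory.Balaban1983to89.T3ContinuumYM3Torus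
open T3SectALandauChart (eta eta_pos)
open B4Sect5Torus (TSite)
open B9SectCLatticeCarrier (Bond)
open B9Eq311L2Pairing (WL2)
open B5Eq118OneStroke (iterBlock iterBlockOf mem_iterBlock card_iterBlock)
open B11Eq103H1Complex (SiteL2K BondL2K covLaplaceSiteK)
open B9Eq310HessianOperator (adTransportW)
open B9Eq315QTower (towerP)
open B9Eq316TowerFlatIsOneStep (siteCast siteL2Cast covLaplaceSiteK_one_siteL2Cast)
open B9Eq326OperatorTower (QprimeTowerW RofUk)
open B9Eq324DeltaPrimeATower (laplacePrimeAk GpOfUk GpOfUk_gaugeMode)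
open Summit.QuantumFields.YangMills.Theorems.Prop7SectET3Transport (periodsT3)
open Summit.QuantumFields.YangMills.Theorems.Prop7SectET3HilbertLetters (W₂ frobEquiv toL2 toL2S DL2 covLapSite covLapSite_eq adBg adBgInv)
open Summit.QuantumFields.YangMills.Theorems.Prop7SectET3GaugeProjector (NS RS exists_mem_NS_RS_eq)
open Summit.QuantumFields.YangMills.Theorems.Prop7SectET3DeltaPi (laplacePrimeA laplacePrimeA_apply_of_mem_NS)
open Summit.QuantumFields.YangMills.Theorems.Prop7SectET3DeltaPiPInv (kerDProj GprimeP GprimeP_laplacePrimeA kerDProj_eq_zero_of_mem_orthogonal)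
open Summit.QuantumFields.YangMills.Theorems.Prop7SectET3RealCoordSums (inner_toL2S)
open Summit.QuantumFields.YangMills.Theorems.Prop7BlockPoincareKerQprime (periodsT3_eq_towerP)
open Summit.QuantumFields.YangMills.Theorems.Prop7BernPFlatMember (DL2_one_toL2S toL2S_mem_NS_one_of_blockSum_eq_zero)
open Summit.QuantumFields.YangMills.Theorems.Prop7FlatResidualAlgebra (toL2S_mem_NS_one_iff covLapSite_one_toL2S_const eq_default_of_forall_shift)
open Summit.QuantumFields.YangMills.Theorems.Prop7FlatGaugeProjectorTower (QprimeTowerW_one_cast_eq_zero_iff siteL2Cast_RS_one adBg_one_eq adBgInv_one_eq adTransportW_one_eq adTransportW_inv_one_eq)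

variable (F : T3Family) [NeZero F.L] (n K : ℕ) (hnK : n < K) (c₀ cB : ℝ) [Fact (0 < c₀)] [Fact (0 < cB)]

/-! ## §1 `ker D_1` = the constant gauge parameters -/

omit [NeZero F.L] [Fact (0 < cB)] in
/-- **`D_1 μ = 0` ⟹ `μ` IS A CONSTANT GAUGE PARAMETER** (`D_1(toL2S λ)(b) = η⁻¹(λ(b₊) − λ(b₋))` by ✓`DL2_one_toL2S`; the torus is connected, ✓`eq_default_of_forall_shift`).
[cite: Balaban1985BackgroundPropagators, (3.3) p.391, (3.21) p.394] -/
theorem exists_const_of_DL2_one_eq_zero (μ : SiteL2K ℂ 3 (periodsT3 F K) c₀ W₂)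
    (hμ : DL2 F n K c₀ (1 : GaugeField (F.P K) 0 (Matrix.specialUnitaryGroup (Fin 2) ℂ)) μ = 0) :
    ∃ Z : Matrix (Fin 2) (Fin 2) ℂ, μ = toL2S F K c₀ (fun _ => Z) := by
  obtain ⟨lam, rfl⟩ : ∃ lam : Site (F.P K) 0 → Matrix (Fin 2) (Fin 2) ℂ, μ = toL2S F K c₀ lam :=
    ⟨(toL2S F K c₀).symm μ, by rw [LinearEquiv.apply_symm_apply]⟩
  rw [DL2_one_toL2S] at hμ
  have h0 : (fun b : PBond (F.P K) 0 => (((eta F n K : ℝ) : ℂ)⁻¹) • (lam b.tgt - lam b.src)) = 0 :=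
    (toL2 F K c₀).injective (by rw [hμ, map_zero])
  have hη : (((eta F n K : ℝ) : ℂ)⁻¹) ≠ 0 := inv_ne_zero (by exact_mod_cast (eta_pos F n K).ne')
  have hshift : ∀ b : PBond (F.P K) 0, lam b.tgt = lam b.src := fun b => by
    have hb := congrFun h0 b
    simp only [Pi.zero_apply, smul_eq_zero, hη, false_or] at hb
    exact sub_eq_zero.1 hb
  refine ⟨lam default, congrArg _ (funext fun x => eq_default_of_forall_shift lam hshift x)⟩

/-! ## §2 Zero block sums ⟹ orthogonal to the constants ⟹ `P₀(1)` kills it -/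

omit [NeZero F.L] [Fact (0 < c₀)] [Fact (0 < cB)] in
/-- A site sum is the sum of its `(K−n)`-block sums. [folklore] -/
theorem sum_eq_sum_blockSum (lam : Site (F.P K) 0 → Matrix (Fin 2) (Fin 2) ℂ) :
    ∑ x : Site (F.P K) 0, lam x = ∑ y : Site (F.P K) (K - n), ∑ x ∈ iterBlock (K - n) y, lam x := by
  classical
  rw [← Finset.sum_fiberwise_of_maps_to (s := (Finset.univ : Finset (Site (F.P K) 0))) (t := (Finset.univ : Finset (Site (F.P K) (K - n))))
    (g := fun x => iterBlockOf (K - n) x) (fun x _ => Finset.mem_univ _)]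
  refine Finset.sum_congr rfl fun y _ => Finset.sum_congr ?_ fun _ _ => rfl
  ext x
  simp only [Finset.mem_filter, Finset.mem_univ, true_and, mem_iterBlock]

omit [NeZero F.L] [Fact (0 < cB)] in
/-- **Zero block sums ⟹ orthogonal to every constant gauge parameter**: `⟪toL2S (x ↦ Z), toL2S λ⟫ = c₀·tr(Zᴴ·Σ_x λ(x)) = 0`. [cite: Balaban1985BackgroundPropagators, p.393, (3.21) p.394] -/
theorem inner_const_toL2S_eq_zero_of_blockSum_eq_zero (lam : Site (F.P K) 0 → Matrix (Fin 2) (Fin 2) ℂ)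
    (hl : ∀ y : Site (F.P K) (K - n), ∑ x ∈ iterBlock (K - n) y, lam x = 0) (Z : Matrix (Fin 2) (Fin 2) ℂ) :
    ⟪toL2S F K c₀ (fun _ => Z), toL2S F K c₀ lam⟫_ℂ = 0 := by
  rw [inner_toL2S, ← Matrix.trace_sum, ← Finset.mul_sum, sum_eq_sum_blockSum F n K lam, Finset.sum_congr rfl fun y _ => hl y, Finset.sum_const_zero,
    mul_zero, Matrix.trace_zero, mul_zero]

omit [NeZero F.L] [Fact (0 < cB)] in
/-- ★ **`P₀(1)μ₀ = 0` FOR A GAUGE PARAMETER WITH ZERO BLOCK SUMS** (`P₀(1)` = the orthogonal projection onto `ker D_1` = constants, §1; `μ₀ ⊥` constants, above).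
[cite: Balaban1985BackgroundPropagators, (3.21)–(3.25) p.394] -/
theorem kerDProj_one_eq_zero_of_blockSum_eq_zero (lam : Site (F.P K) 0 → Matrix (Fin 2) (Fin 2) ℂ)
    (hl : ∀ y : Site (F.P K) (K - n), ∑ x ∈ iterBlock (K - n) y, lam x = 0) :
    kerDProj F n K c₀ (1 : GaugeField (F.P K) 0 (Matrix.specialUnitaryGroup (Fin 2) ℂ)) (toL2S F K c₀ lam) = 0 := by
  refine kerDProj_eq_zero_of_mem_orthogonal _ ((Submodule.mem_orthogonal _ _).2 fun k hk => ?_)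
  obtain ⟨Z, rfl⟩ := exists_const_of_DL2_one_eq_zero F n K c₀ k (LinearMap.mem_ker.1 hk)
  exact inner_const_toL2S_eq_zero_of_blockSum_eq_zero F n K c₀ lam hl Z

/-! ## §3 The two Green's functions agree on the range of the projector -/

omit [NeZero F.L] in
/-- **`G′ᴾ(1)(Δ^η_1 μ₀) = μ₀` FOR ZERO BLOCK SUMS** (`μ₀ ∈ N_S(1)` ✓`toL2S_mem_NS_one_of_blockSum_eq_zero`, `Δ′_a(1)μ₀ = Δ^η_1μ₀` ✓`laplacePrimeA_apply_of_mem_NS`, ★★✓`GprimeP_laplacePrimeA`,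
`P₀(1)μ₀ = 0`), for every `0 ≤ a`. [cite: Balaban1985BackgroundPropagators, (3.24)–(3.25) p.394] -/
theorem GprimeP_one_covLapSite_of_blockSum_eq_zero {a : ℝ} (ha : 0 ≤ a) (lam : Site (F.P K) 0 → Matrix (Fin 2) (Fin 2) ℂ)
    (hl : ∀ y : Site (F.P K) (K - n), ∑ x ∈ iterBlock (K - n) y, lam x = 0) :
    GprimeP F n K hnK.le c₀ cB a 1 (covLapSite F n K c₀ 1 (toL2S F K c₀ lam)) = toL2S F K c₀ lam := by
  have hNS := toL2S_mem_NS_one_of_blockSum_eq_zero (F := F) (n := n) (K := K) (h := hnK.le) (c₀ := c₀) (cB := cB) lam hl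
  rw [← laplacePrimeA_apply_of_mem_NS (a := a) 1 hNS, GprimeP_laplacePrimeA ha, kerDProj_one_eq_zero_of_blockSum_eq_zero F n K c₀ lam hl, sub_zero]

omit [NeZero F.L] [Fact (0 < cB)] in
/-- **THE FLAT SITE LAPLACIAN CROSSES THE CAST**: `Δ_tower,1 (Φ l) = Φ (Δ^η_1 l)` (lit ✓`covLaplaceSiteK_one_siteL2Cast`; all four transporter families at `1` are the identity).
[cite: Balaban1985BackgroundPropagators, (3.23) p.394] -/
theorem covLaplaceSiteK_one_cast (l : SiteL2K ℂ 3 (periodsT3 F K) c₀ W₂) :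
    haveI : ∀ i : Fin 3, NeZero ((fun _ : Fin 3 => (F.P K).sitesPerDir (K - n)) i) := fun _ => inferInstance
    covLaplaceSiteK (((eta F n K : ℝ) : ℂ)⁻¹)
        (adTransportW frobEquiv (fun _ : Bond 3 (towerP F.L (fun _ : Fin 3 => (F.P K).sitesPerDir (K - n)) (K - n - 1 + 1)) => (1 : (Matrix (Fin 2) (Fin 2) ℂ)ˣ)))
        (adTransportW frobEquiv fun _ : Bond 3 (towerP F.L (fun _ : Fin 3 => (F.P K).sitesPerDir (K - n)) (K - n - 1 + 1)) => (1 : (Matrix (Fin 2) (Fin 2) ℂ)ˣ)⁻¹)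
        (siteL2Cast ℂ (periodsT3_eq_towerP F n K hnK) l) =
      siteL2Cast ℂ (periodsT3_eq_towerP F n K hnK) (covLapSite F n K c₀ 1 l) := by
  haveI : ∀ i : Fin 3, NeZero ((fun _ : Fin 3 => (F.P K).sitesPerDir (K - n)) i) := fun _ => inferInstance
  have h1 := covLaplaceSiteK_one_siteL2Cast (𝔸 := Matrix (Fin 2) (Fin 2) ℂ) frobEquiv (c₀ := c₀) (periodsT3_eq_towerP F n K hnK) (((eta F n K : ℝ) : ℂ)⁻¹) l
  rw [h1, covLapSite_eq, adBg_one_eq, adBgInv_one_eq, adTransportW_one_eq, adTransportW_inv_one_eq]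

/-- ★★★ **THE ROUTE's `G′ᴾ(1)∘R_S(1)` IS THE TOWER's `G′_k(1)∘R_k(1)` ALONG THE PERIOD CAST**, for every `0 ≤ a`, `0 < a′` and every positivity witness `hpos′` of the tower's
`Δ′_{a′,k}(1)`: `Φ (G′ᴾ(1)(R_S(1) l)) = G′_k(1)(R_k(1)(Φ l))`, `Φ := siteL2Cast ℂ (periodsT3_eq_towerP F n K hnK)`.
[cite: Balaban1985BackgroundPropagators, (3.21)–(3.25) p.394, (3.115) p.418; Balaban1984PropagatorsII, (2.10)–(2.12) p.225] -/
theorem siteL2Cast_GprimeP_RS_one {a : ℝ} (ha : 0 ≤ a) (a' c₁ : ℝ) [Fact (0 < c₁)]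
    (hpos' : haveI : ∀ i : Fin 3, NeZero ((fun _ : Fin 3 => (F.P K).sitesPerDir (K - n)) i) := fun _ => inferInstance
      ∀ x : SiteL2K ℂ 3 (towerP F.L (fun _ : Fin 3 => (F.P K).sitesPerDir (K - n)) (K - n - 1 + 1)) c₀ W₂, x ≠ 0 →
        0 < RCLike.re ⟪x, laplacePrimeAk F.L (fun _ : Fin 3 => (F.P K).sitesPerDir (K - n)) (K - n - 1) frobEquiv (eta F n K)
          (fun _ : Bond 3 (towerP F.L (fun _ : Fin 3 => (F.P K).sitesPerDir (K - n)) (K - n - 1 + 1)) => (1 : (Matrix (Fin 2) (Fin 2) ℂ)ˣ)) a'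
          (c₁ := c₁) x⟫_ℂ)
    (l : SiteL2K ℂ 3 (periodsT3 F K) c₀ W₂) :
    haveI : ∀ i : Fin 3, NeZero ((fun _ : Fin 3 => (F.P K).sitesPerDir (K - n)) i) := fun _ => inferInstance
    siteL2Cast ℂ (periodsT3_eq_towerP F n K hnK)
        (GprimeP F n K hnK.le c₀ cB a (1 : GaugeField (F.P K) 0 (Matrix.specialUnitaryGroup (Fin 2) ℂ))
          (RS F n K hnK.le c₀ cB (1 : GaugeField (F.P K) 0 (Matrix.specialUnitaryGroup (Fin 2) ℂ)) l)) =
      GpOfUk F.L (fun _ : Fin 3 => (F.P K).sitesPerDir (K - n)) (K - n - 1) frobEquiv (eta F n K)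
        (fun _ : Bond 3 (towerP F.L (fun _ : Fin 3 => (F.P K).sitesPerDir (K - n)) (K - n - 1 + 1)) => (1 : (Matrix (Fin 2) (Fin 2) ℂ)ˣ)) a'
        (c₁ := c₁) hpos'
        (RofUk F.L (fun _ : Fin 3 => (F.P K).sitesPerDir (K - n)) (K - n - 1) frobEquiv (eta F n K)
          (fun _ : Bond 3 (towerP F.L (fun _ : Fin 3 => (F.P K).sitesPerDir (K - n)) (K - n - 1 + 1)) => (1 : (Matrix (Fin 2) (Fin 2) ℂ)ˣ)) (c₀ := c₀)
          (siteL2Cast ℂ (periodsT3_eq_towerP F n K hnK) l)) := by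
  classical
  haveI : ∀ i : Fin 3, NeZero ((fun _ : Fin 3 => (F.P K).sitesPerDir (K - n)) i) := fun _ => inferInstance
  -- `R_S(1) l = Δ^η_1 μ`, `μ ∈ N_S(1)`
  obtain ⟨μ, hμNS, hRl⟩ := exists_mem_NS_RS_eq (F := F) (n := n) (K := K) (h := hnK.le) (c₀ := c₀) (cB := cB)
    (1 : GaugeField (F.P K) 0 (Matrix.specialUnitaryGroup (Fin 2) ℂ)) l
  obtain ⟨lam, rfl⟩ : ∃ lam : Site (F.P K) 0 → Matrix (Fin 2) (Fin 2) ℂ, μ = toL2S F K c₀ lam :=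
    ⟨(toL2S F K c₀).symm μ, by rw [LinearEquiv.apply_symm_apply]⟩
  -- constant block sums; subtract the constant
  obtain ⟨C, hC⟩ := (toL2S_mem_NS_one_iff F n K hnK.le c₀ cB lam).1 hμNS
  have hk : K - n ≤ (F.P K).m + (F.P K).K := by
    show K - n ≤ F.m + K
    exact le_trans (Nat.sub_le K n) (Nat.le_add_left K F.m)
  set N : ℕ := ((F.P K).L ^ (F.P K).d) ^ (K - n) with hN
  have hN0 : (N : ℂ) ≠ 0 := by rw [hN]; exact_mod_cast pow_ne_zero _ (pow_ne_zero _ (F.P K).L_pos.ne')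
  set Z : Matrix (Fin 2) (Fin 2) ℂ := ((N : ℂ)⁻¹) • C with hZ
  set lam₀ : Site (F.P K) 0 → Matrix (Fin 2) (Fin 2) ℂ := fun x => lam x - Z with hlam₀
  have hsplit : toL2S F K c₀ lam = toL2S F K c₀ lam₀ + toL2S F K c₀ (fun _ => Z) := by
    rw [← map_add]; congr 1; funext x; simp [hlam₀]
  have hzero : ∀ y : Site (F.P K) (K - n), ∑ x ∈ iterBlock (K - n) y, lam₀ x = 0 := by
    intro y
    simp only [hlam₀]
    rw [Finset.sum_sub_distrib, hC y, Finset.sum_const, card_iterBlock (K - n) hk, ← hN, hZ, ← Nat.cast_smul_eq_nsmul ℂ, smul_smul,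
      mul_inv_cancel₀ hN0, one_smul, sub_self]
  have hΔμ : covLapSite F n K c₀ 1 (toL2S F K c₀ lam) = covLapSite F n K c₀ 1 (toL2S F K c₀ lam₀) := by
    rw [hsplit, map_add, covLapSite_one_toL2S_const, add_zero]
  -- route side: `G′ᴾ(1)(R_S(1) l) = μ₀`
  have hroute : GprimeP F n K hnK.le c₀ cB a (1 : GaugeField (F.P K) 0 (Matrix.specialUnitaryGroup (Fin 2) ℂ))
      (RS F n K hnK.le c₀ cB (1 : GaugeField (F.P K) 0 (Matrix.specialUnitaryGroup (Fin 2) ℂ)) l) = toL2S F K c₀ lam₀ := by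
    rw [hRl, hΔμ, GprimeP_one_covLapSite_of_blockSum_eq_zero F n K hnK c₀ cB ha lam₀ hzero]
  -- tower side: `R_k(1)(Φ l) = Φ(R_S(1) l) = Δ_tower (Φ μ₀)` and `Q̃′_k(1)(Φ μ₀) = 0`
  have hR := siteL2Cast_RS_one F n K hnK c₀ cB l
  have hQ0 := (QprimeTowerW_one_cast_eq_zero_iff F n K hnK c₀ lam₀).2 hzero
  have hG := GpOfUk_gaugeMode F.L (fun _ : Fin 3 => (F.P K).sitesPerDir (K - n)) (K - n - 1) frobEquiv (eta F n K)
    (fun _ : Bond 3 (towerP F.L (fun _ : Fin 3 => (F.P K).sitesPerDir (K - n)) (K - n - 1 + 1)) => (1 : (Matrix (Fin 2) (Fin 2) ℂ)ˣ)) a'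
    (c₁ := c₁) hpos' (siteL2Cast ℂ (periodsT3_eq_towerP F n K hnK) (toL2S F K c₀ lam₀)) hQ0
  rw [hroute, ← hR, hRl, hΔμ, ← covLaplaceSiteK_one_cast F n K hnK c₀ (toL2S F K c₀ lam₀)]
  exact hG.symm

end Summit.QuantumFields.YangMills.Theorems.Prop7FlatGprimeRSTower

end
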